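import Summits.QuantumFields.BalabanUV.Beta.FP.FineSplitJunctionGen
import Summits.QuantumFields.BalabanUV.Beta.FP.FineSplitJunctionLedger

/-!
# `BalabanUV.Beta.FP.FineSplitJunctionLedgerGen` — road «FP» for binder row D1, ROW KER-γ, RULING R-FP-40 row «E-COLS» (TAKEN CLAIMS 2026-08-21 l.28847, statement
# l.28858), sequel of `FP/FineSplitJunctionGen`: THE NEAR–FAR END AND THE LEDGER END OF THE (α0) JUNCTION WITH EVERYTHING ROAD-SPECIFIC ABSTRACT — the coarse tables
# `T m`, the fine tables `F m` (sandwich `hsand` through the base-`0` columns of `Kp m` and boundedness `hFb` DISPLAYED), the END columns `colOf (Kp m)` with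
# (L0)(L1)(LE)(LS), and the reflection letter `hKcov` — `hasym_PiBF_of_near_far_gen`, `hasym_PiBF_of_far_nearPieces_gen` (the tree's `FineSplitJunctionNearFar` ∕
# `…Ledger` ENDs at `T m := TPerfOf …`, `F m := fineHessA (axDressK …) (coProj …) …`, `Kp m := KPerf … m` are their AXIAL instances; the literal of record (R40-a)
# instantiates at `Kp m := G^s_m` with `hsand` from the owner's `GenericResolventSandwich.hessKer_self_eq_dressedEntryP`)

HONEST DEPENDENCY (page 1, mandatory): continuum YM on T⁴ ⇐ BetaPertH ∧ nine spine estimates (0/9 proved); BetaPertH ⇐ (D1) ∧ (D4) ∧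
CAP+tail; G-an2-4 gates asym, D1 and NE2/3/4.  HONEST FRAMING (cell contract, verbatim): «discharging `BetaPertH` makes Bałaban's UV
stability UNCONDITIONAL — a real constructive-QFT result; it is NOT the continuum limit and NOT the Clay problem.»  THIS MODULE is [our object]
COMPOSITION BY NAME: the two tree ENDs' bodies verbatim with the B-link (`FineSplitJunctionBiVertex`'s sandwich discharge) turned into the hypothesis `hsand`, the fine-table
bound `exists_bound_fineHessA_perfect` into `hFb`, `rem_far_perfCol` into `FineSplitJunctionGen.rem_far_gen`, and the column summability from (LE); no `def`, no
`def … : Prop`, nothing cited, nothing of the manuscripts under audit asserted, 0 sorry; no existing file touched.  NOT COL-SYM, NOT hsplit, NOT (ASYMP) for the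
literal, NOT D1; 0∕4 row-D1 binders; NOT BetaPertH, NOT continuum, NOT Clay.

ABSOLUTE RULE (cell charter, verbatim): «No internally-minted statement may enter as a cited fact. Every hypothesis is either kernel-proved in this
package or a verbatim quotation of a PUBLISHED theorem with page reference. The manuscript(s) under audit are NOT citable for their own disputed
steps — they are the thing under adjudication; programme-internal (2001/route/tribunal) claims are never citable.»

CONTENT ([our object]): §1 **`hasym_PiBF_of_near_far_gen`**; §2 **`hasym_PiBF_of_far_nearPieces_gen`** (the (LEDGER) skeleton's input END, everything road-specific displayed).
Provenance: D1 formalisation swarm LEAF PROVER 01, unit `b2b-balaban-beta-d1-formalise-leaf-01` gen 12, 2026-08-21, road FP row E-COLS (R-FP-40).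
-/

noncomputable section

namespace Summit.QuantumFields.BalabanUV.Beta.FP.FineSplitJunctionLedgerGen

open Finset
open scoped BigOperators
open Literature.MathematicalPhysics.QuantumFieldTheory.Balaban1983to89
open Literature.MathematicalPhysics.QuantumFieldTheory.Balaban1983to89.Beta
open Literature.MathematicalPhysics.QuantumFieldTheory.Balaban1983to89.Beta.BubbleTransfer (c4)
open Literature.MathematicalPhysics.QuantumFieldTheory.Balaban1983to89.B12Normalization (stepBal)
open B12Sec2to5 (l1 l1_nonneg)
open PolarizationSign (AxisReflectionCovariant reflSign)
open ExpKernelCalculus (Site MKer Decays BiLoc comp shiftK tr tadpole bubble Zl Zl_nonneg)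
open OneStepResolventKernel (Fib LocStencil)
open OneStepKernelFamily (flipK colH)
open KernelWard (divV divW)
open KernelReflection (LegMap refK bondRefl)
open DyadicShell (Pt supNorm)
open DecimatedMomentSummable (ConstReproSum LinReproSum AbsMoment₂)
open DressedMomentNormalisation (EKer dressedEntry)
open LeadingCoefficient (kappaBal)
open Summit.QuantumFields.BalabanUV.Beta.GAN24.CombesThomas (sfStep smStep)
open Summit.QuantumFields.BalabanUV.Beta.D1BFx.MomentTransferPeriodicSum (dressedSumP)
open Summit.QuantumFields.BalabanUV.Beta.D1BFx.MomentTransferPeriodicEntry (EKer₂ dressedEntryP)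
open Summit.QuantumFields.BalabanUV.Beta.FP.PerfectObjectsT (KPerf)
open Summit.QuantumFields.BalabanUV.Beta.FP.TransportInfinityM (colOf)
open Summit.QuantumFields.BalabanUV.Beta.FP.HorizontalBookkeeping (truncK truncK_apply)
open Summit.QuantumFields.BalabanUV.Beta.FP.WilsonCubicGerm (cubicGermOf)
open Summit.QuantumFields.BalabanUV.Beta.FP.GhostCubicGerm (cubicGermOfSc)
open Summit.QuantumFields.BalabanUV.Beta.FP.BubbleGermValue (bfGerm ghostGerm)
open Summit.QuantumFields.BalabanUV.Beta.FP.PerfectPolarization (Pker G0ker PiBF)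
open Summit.QuantumFields.BalabanUV.Beta.FP.PerfectPolarizationDecay (sextic_PiBF)
open Summit.QuantumFields.BalabanUV.Beta.FP.FineSplitJunction (dressedEntryP_split summable_abs_colH_of_colOf)
open Summit.QuantumFields.BalabanUV.Beta.FP.FineSplitJunctionNearFar (fineSplit_near_far)
open Summit.QuantumFields.BalabanUV.Beta.FP.FineSplitJunctionLedger (rem_dressedEntryP_sum)
open Summit.QuantumFields.BalabanUV.Beta.FP.FineSplitJunctionGen (rem_far_gen hasym_PiBF_of_fineSplit_gen)

variable {Lc : ℕ} [NeZero Lc]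

/-! ## §1 The near–far END, everything road-specific abstract -/

/-- [our object] `FineSplitJunctionNearFar.hasym_PiBF_vertex2OfK_of_near_far` with `T`, `F`, the columns and (Kcov) ABSTRACT: (ASYMP) for the coarse tables `T m` ⟸
{H2V-4 letters, `hKcov`, colour `hn`, (L0)(L1)(LE)(LS) of `colOf (Kp m)`, `hsand`, `hFb`, the far letter `hfar` on `F m`, ONE near number `Bnear`}. -/
theorem hasym_PiBF_of_near_far_gen (hLc : 2 ≤ Lc) (wg wgh : ℝ)
    {V : Fin 4 → Site 4 → MKer 4 (Fib 3)} {W : Fin 4 → Site 4 → Fin 4 → Site 4 → MKer 4 (Fib 3)}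
    {v : Fin 4 → Site 4 → MKer 4 Unit} {w : Fin 4 → Site 4 → Fin 4 → Site 4 → MKer 4 Unit} {Cv Cw Cx Cw' Cx' CwL CwL' cQ δ : ℝ} (hδ : 0 < δ)
    -- admissible-family letters, gluon sector
    (hV : ∀ (μ : Fin 4) (y : Site 4), BiLoc (V μ y) y y Cv δ) (hW : ∀ (μ : Fin 4) (y : Site 4) (ν : Fin 4) (y' : Site 4), BiLoc (W μ y ν y') y y' Cw δ)
    (hcovV : ∀ (μ : Fin 4) (y t : Site 4), V μ (y + t) = shiftK (-t) (V μ y))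
    (hcovW : ∀ (μ : Fin 4) (y : Site 4) (ν : Fin 4) (y' t : Site 4), W μ (y + t) ν (y' + t) = shiftK (-t) (W μ y ν y'))
    (X : Site 4 → MKer 4 (Fib 3)) (hX : ∀ y, BiLoc (X y) y y Cx δ)
    (hW1 : ∀ y, comp (comp Pker (divV V y)) Pker = comp Pker (X y) - comp (X y) Pker)
    (hW2 : ∀ y ν y', divW W y ν y' = comp (X y) (V ν y') - comp (V ν y') (X y))
    (hKcov : AxisReflectionCovariant (flipK (PiBF wg wgh V W v w)))
    (h0V : ∀ (lam α β : Fin 4), ∑' p : Pt × Pt, V lam 0 p.1 p.2 (Sum.inl α) (Sum.inl β) = 0)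
    (hgermV : cubicGermOf V = cQ • bfGerm)
    (hWloc : ∀ (μ ν : Fin 4) (z : Pt), BiLoc (W μ 0 ν z) 0 z (CwL * Real.exp (-δ * l1 z)) δ)
    -- admissible-family letters, ghost sector
    (hv : ∀ (μ : Fin 4) (y : Site 4), BiLoc (v μ y) y y Cv δ) (hw : ∀ (μ : Fin 4) (y : Site 4) (ν : Fin 4) (y' : Site 4), BiLoc (w μ y ν y') y y' Cw' δ)
    (hcovv : ∀ (μ : Fin 4) (y t : Site 4), v μ (y + t) = shiftK (-t) (v μ y))
    (hcovw : ∀ (μ : Fin 4) (y : Site 4) (ν : Fin 4) (y' t : Site 4), w μ (y + t) ν (y' + t) = shiftK (-t) (w μ y ν y'))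
    (Xg : Site 4 → MKer 4 Unit) (hXg : ∀ y, BiLoc (Xg y) y y Cx' δ)
    (hW1g : ∀ y, comp (comp G0ker (divV v y)) G0ker = comp G0ker (Xg y) - comp (Xg y) G0ker)
    (hW2g : ∀ y ν y', divW w y ν y' = comp (Xg y) (v ν y') - comp (v ν y') (Xg y))
    (h0v : ∀ lam : Fin 4, ∑' p : Pt × Pt, v lam 0 p.1 p.2 () () = 0)
    (hgermv : cubicGermOfSc v = ghostGerm)
    (hwloc : ∀ (μ ν : Fin 4) (z : Pt), BiLoc (w μ 0 ν z) 0 z (CwL' * Real.exp (-δ * l1 z)) δ)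
    -- the colour weights and the entry
    {N : ℝ} (hn : (40 * wg * (1 / 4 : ℝ) * (c4 * cQ) ^ 2 - wgh * (-(1 / 2 : ℝ)) * c4 ^ 2) / 3 = kappaBal N)
    {μ ν : Fin 4} (hμν : μ ≠ ν)
    -- THE ABSTRACT COLUMN FAMILY: a packed `Kp m` with the m-UNIFORM END transport letters (L0)(L1)(LE) of `colOf (Kp m)`
    {Kp : ℕ → MKer (3 + 1) (Fib 3)} {δc cc : ℝ} (hδc : 0 < δc) (hcc : 0 ≤ cc)
    (hw0 : ∀ m : ℕ, 1 ≤ m → ∀ κ l, ConstReproSum (Lc ^ m) (colOf (Kp m) κ l)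
      (if κ = l then ((((Lc ^ m : ℕ) : ℝ) ^ (4 + 1))⁻¹) else 0))
    (hw1 : ∀ m : ℕ, 1 ≤ m → ∃ Cw : Fin 4 → Fin 4 → Fin 4 → ℝ, ∀ κ l, LinReproSum (Lc ^ m) (colOf (Kp m) κ l) (Cw κ l))
    (hwE : ∀ m : ℕ, 1 ≤ m → ∀ κ l, Summable fun x : Pt => Real.exp (δc / ((Lc ^ m : ℕ) : ℝ) * l1 x) * |colOf (Kp m) κ l x|)
    (hwEb : ∀ m : ℕ, 1 ≤ m → ∀ κ l,
      ∑' x : Pt, Real.exp (δc / ((Lc ^ m : ℕ) : ℝ) * l1 x) * |colOf (Kp m) κ l x| ≤ cc / ((Lc ^ m : ℕ) : ℝ))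
    -- the SHARP sup letter (LS) of the columns (for the far piece)
    {Cs κs : ℝ} (hCs : 0 ≤ Cs) (hκs : 0 < κs)
    (hws : ∀ m : ℕ, 1 ≤ m → ∀ (κ l : Fin 4) (x : Pt),
      |colOf (Kp m) κ l x| ≤ Cs / ((Lc ^ m : ℕ) : ℝ) ^ 5 * Real.exp (-(κs / ((Lc ^ m : ℕ) : ℝ)) * l1 x))
    -- THE ABSTRACT COARSE AND FINE TABLES: the sandwich through the base-`0` columns of `Kp m`; bounded fine entries
    {T : ℕ → Fin 4 → Fin 4 → Pt → ℝ} {F : ℕ → EKer₂ 4}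
    (hsand : ∀ m : ℕ, 1 ≤ m → ∀ u : Pt,
      T m μ ν u = dressedEntryP (fun c a => colH (Kp m) (Lc ^ m) a 0 c) (F m) (((Lc ^ m : ℕ) : ℤ) • (-u)) μ ν)
    (hFb : ∀ m : ℕ, 1 ≤ m → ∀ c e : Fin 4, ∃ A, ∀ s s', |F m c e s s'| ≤ A)
    -- the FAR LETTER of the full fine kernel (m-free shape) and the NEAR LEDGER (one number)
    {CF a : ℝ} (hCF : 0 ≤ CF) (ha : 0 < a)
    (hfar : ∀ m : ℕ, 1 ≤ m → ∀ (c e : Fin 4) (s s' : Pt), Lc ^ m < supNorm (s' - s) →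
      |F m c e s s'|
        ≤ ((Lc ^ m : ℕ) : ℝ) ^ 8 * (CF / (supNorm (s' - s) : ℝ) ^ 6 * Real.exp (-(a / ((Lc ^ m : ℕ) : ℝ)) * (supNorm (s' - s) : ℝ))))
    {Bnear : ℝ}
    (hnear : ∀ m : ℕ, 1 ≤ m → ∀ S' : Finset Pt, ∑ u ∈ S', (supNorm u : ℝ) ^ 2 *
      |dressedEntryP (fun c a' => colH (Kp m) (Lc ^ m) a' 0 c)
        (fun c e s s' => if supNorm (s' - s) ≤ Lc ^ m then
          F m c e s s'
            - ((Lc ^ m : ℕ) : ℝ) ^ 8 * PiBF wg wgh V W v w c e (s' - s) else 0)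
        (((Lc ^ m : ℕ) : ℤ) • (-u)) μ ν| ≤ Bnear) :
    ∃ U : ℝ, 0 ≤ U ∧ ∃ Cg : ℝ, ∀ m : ℕ, 1 ≤ m →
      |B12Beta.secondMoment (T m) μ ν - (m : ℝ) * stepBal N Lc|
        ≤ (U + Bnear) + Cg := by
  -- the two pieces (terms, not definitions)
  set G : Bool → ℕ → EKer₂ 4 := fun i m c e s s' =>
    cond i (if Lc ^ m < supNorm (s' - s) then F m c e s s' else 0)
      (if supNorm (s' - s) ≤ Lc ^ m then F m c e s s' - ((Lc ^ m : ℕ) : ℝ) ^ 8 * PiBF wg wgh V W v w c e (s' - s) else 0) with hGdef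
  -- (K6): a bound of `PiBF`
  have hLoc : LocStencil V Cv δ := fun κ u => hV κ u
  have hcovV0 : ∀ (lam : Fin 4) (u : Site 4), V lam u = shiftK (-u) (V lam 0) := fun lam u => by
    have h := hcovV lam 0 u; rwa [zero_add] at h
  have hcovv0 : ∀ (lam : Fin 4) (u : Site 4), v lam u = shiftK (-u) (v lam 0) := fun lam u => by
    have h := hcovv lam 0 u; rwa [zero_add] at h
  obtain ⟨CP, hCP0, hKP⟩ := sextic_PiBF (wg := wg) (wgh := wgh) (cQ := cQ) hδ hLoc hcovV0 h0V hgermV hWloc hv hcovv0 h0v hgermv hwloc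
  have hPb : ∀ (c e : Fin 4) (t : Pt), |PiBF wg wgh V W v w c e t| ≤ CP := fun c e t =>
    (hKP c e t).trans (div_le_self hCP0 (one_le_pow₀ (by
      have : (0 : ℝ) ≤ (supNorm t : ℝ) := Nat.cast_nonneg _
      linarith)))
  -- the far entry of the ledger, m-free
  obtain ⟨Bfar, hBfar0, hBfar⟩ := rem_far_gen (Lc := Lc) hLc hCs hκs hws (G := G true) (μ := μ) (ν := ν) hCF ha
    (fun m hm c e s s' hfs => by
      show |(if Lc ^ m < supNorm (s' - s) then F m c e s s' else 0)| ≤ _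
      rw [if_pos hfs]; exact hfar m hm c e s s' hfs)
    (fun m hm c e s s' hns => by
      show (if Lc ^ m < supNorm (s' - s) then F m c e s s' else 0) = 0
      rw [if_neg (not_lt.mpr hns)])
  -- the composition
  obtain ⟨U₀, hU₀, Cg, hmain⟩ := hasym_PiBF_of_fineSplit_gen hLc wg wgh hδ hV hW hcovV hcovW X hX hW1 hW2 hKcov h0V hgermV hWloc
    hv hw hcovv hcovw Xg hXg hW1g hW2g h0v hgermv hwloc hn hμν hδc hcc hw0 hw1 hwE hwEb (T := T) (F := F)
    (Finset.univ : Finset Bool) (G := G) (B := fun i => cond i Bfar Bnear) hsand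
    (fun m hm c e s s' => by
      have h := fineSplit_near_far (F m) (PiBF wg wgh V W v w) (((Lc ^ m : ℕ) : ℝ) ^ 8) (Lc ^ m) c e s s'
      simpa only [hGdef] using h)
    (fun i _ m hm c e => by
      obtain ⟨AF, hAF⟩ := hFb m hm c e
      have hAF0 : 0 ≤ AF := (abs_nonneg _).trans (hAF 0 0)
      refine ⟨AF + ((Lc ^ m : ℕ) : ℝ) ^ 8 * CP, fun s s' => ?_⟩
      cases i with
      | true =>
        show |(if Lc ^ m < supNorm (s' - s) then F m c e s s' else 0)| ≤ _
        split_ifs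
        · exact (hAF s s').trans (le_add_of_nonneg_right (by positivity))
        · rw [abs_zero]; positivity
      | false =>
        show |(if supNorm (s' - s) ≤ Lc ^ m then F m c e s s' - ((Lc ^ m : ℕ) : ℝ) ^ 8 * PiBF wg wgh V W v w c e (s' - s) else 0)| ≤ _
        split_ifs
        · refine (abs_sub _ _).trans (add_le_add (hAF s s') ?_)
          rw [abs_mul, abs_pow, Nat.abs_cast]
          exact mul_le_mul_of_nonneg_left (hPb c e _) (by positivity)
        · rw [abs_zero]; positivity)
    (fun i _ m hm S' => by
      cases i with
      | true => exact hBfar m hm S'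
      | false => exact hnear m hm S')
  refine ⟨U₀ + Bfar, add_nonneg hU₀ hBfar0, Cg, fun m hm => ?_⟩
  have h := hmain m hm
  rw [Fintype.sum_bool] at h
  simp only [cond_true, cond_false] at h
  linarith

/-! ## §2 The ledger END, everything road-specific abstract -/

/-- [our object] `FineSplitJunctionLedger.hasym_PiBF_vertex2OfK_of_far_nearPieces` with `T`, `F`, the columns and (Kcov) ABSTRACT — the near number is the sum of a
finite ledger of bounded pieces (`rem_dressedEntryP_sum` BY NAME). -/
theorem hasym_PiBF_of_far_nearPieces_gen (hLc : 2 ≤ Lc) (wg wgh : ℝ)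
    {V : Fin 4 → Site 4 → MKer 4 (Fib 3)} {W : Fin 4 → Site 4 → Fin 4 → Site 4 → MKer 4 (Fib 3)}
    {v : Fin 4 → Site 4 → MKer 4 Unit} {w : Fin 4 → Site 4 → Fin 4 → Site 4 → MKer 4 Unit} {Cv Cw Cx Cw' Cx' CwL CwL' cQ δ : ℝ} (hδ : 0 < δ)
    -- admissible-family letters, gluon sector
    (hV : ∀ (μ : Fin 4) (y : Site 4), BiLoc (V μ y) y y Cv δ) (hW : ∀ (μ : Fin 4) (y : Site 4) (ν : Fin 4) (y' : Site 4), BiLoc (W μ y ν y') y y' Cw δ)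
    (hcovV : ∀ (μ : Fin 4) (y t : Site 4), V μ (y + t) = shiftK (-t) (V μ y))
    (hcovW : ∀ (μ : Fin 4) (y : Site 4) (ν : Fin 4) (y' t : Site 4), W μ (y + t) ν (y' + t) = shiftK (-t) (W μ y ν y'))
    (X : Site 4 → MKer 4 (Fib 3)) (hX : ∀ y, BiLoc (X y) y y Cx δ)
    (hW1 : ∀ y, comp (comp Pker (divV V y)) Pker = comp Pker (X y) - comp (X y) Pker)
    (hW2 : ∀ y ν y', divW W y ν y' = comp (X y) (V ν y') - comp (V ν y') (X y))
    (hKcov : AxisReflectionCovariant (flipK (PiBF wg wgh V W v w)))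
    (h0V : ∀ (lam α β : Fin 4), ∑' p : Pt × Pt, V lam 0 p.1 p.2 (Sum.inl α) (Sum.inl β) = 0)
    (hgermV : cubicGermOf V = cQ • bfGerm)
    (hWloc : ∀ (μ ν : Fin 4) (z : Pt), BiLoc (W μ 0 ν z) 0 z (CwL * Real.exp (-δ * l1 z)) δ)
    -- admissible-family letters, ghost sector
    (hv : ∀ (μ : Fin 4) (y : Site 4), BiLoc (v μ y) y y Cv δ) (hw : ∀ (μ : Fin 4) (y : Site 4) (ν : Fin 4) (y' : Site 4), BiLoc (w μ y ν y') y y' Cw' δ)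
    (hcovv : ∀ (μ : Fin 4) (y t : Site 4), v μ (y + t) = shiftK (-t) (v μ y))
    (hcovw : ∀ (μ : Fin 4) (y : Site 4) (ν : Fin 4) (y' t : Site 4), w μ (y + t) ν (y' + t) = shiftK (-t) (w μ y ν y'))
    (Xg : Site 4 → MKer 4 Unit) (hXg : ∀ y, BiLoc (Xg y) y y Cx' δ)
    (hW1g : ∀ y, comp (comp G0ker (divV v y)) G0ker = comp G0ker (Xg y) - comp (Xg y) G0ker)
    (hW2g : ∀ y ν y', divW w y ν y' = comp (Xg y) (v ν y') - comp (v ν y') (Xg y))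
    (h0v : ∀ lam : Fin 4, ∑' p : Pt × Pt, v lam 0 p.1 p.2 () () = 0)
    (hgermv : cubicGermOfSc v = ghostGerm)
    (hwloc : ∀ (μ ν : Fin 4) (z : Pt), BiLoc (w μ 0 ν z) 0 z (CwL' * Real.exp (-δ * l1 z)) δ)
    -- the colour weights and the entry
    {N : ℝ} (hn : (40 * wg * (1 / 4 : ℝ) * (c4 * cQ) ^ 2 - wgh * (-(1 / 2 : ℝ)) * c4 ^ 2) / 3 = kappaBal N)
    {μ ν : Fin 4} (hμν : μ ≠ ν)
    -- THE ABSTRACT COLUMN FAMILY: a packed `Kp m` with the m-UNIFORM END transport letters (L0)(L1)(LE) of `colOf (Kp m)`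
    {Kp : ℕ → MKer (3 + 1) (Fib 3)} {δc cc : ℝ} (hδc : 0 < δc) (hcc : 0 ≤ cc)
    (hw0 : ∀ m : ℕ, 1 ≤ m → ∀ κ l, ConstReproSum (Lc ^ m) (colOf (Kp m) κ l)
      (if κ = l then ((((Lc ^ m : ℕ) : ℝ) ^ (4 + 1))⁻¹) else 0))
    (hw1 : ∀ m : ℕ, 1 ≤ m → ∃ Cw : Fin 4 → Fin 4 → Fin 4 → ℝ, ∀ κ l, LinReproSum (Lc ^ m) (colOf (Kp m) κ l) (Cw κ l))
    (hwE : ∀ m : ℕ, 1 ≤ m → ∀ κ l, Summable fun x : Pt => Real.exp (δc / ((Lc ^ m : ℕ) : ℝ) * l1 x) * |colOf (Kp m) κ l x|)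
    (hwEb : ∀ m : ℕ, 1 ≤ m → ∀ κ l,
      ∑' x : Pt, Real.exp (δc / ((Lc ^ m : ℕ) : ℝ) * l1 x) * |colOf (Kp m) κ l x| ≤ cc / ((Lc ^ m : ℕ) : ℝ))
    -- the SHARP sup letter (LS) of the columns (for the far piece)
    {Cs κs : ℝ} (hCs : 0 ≤ Cs) (hκs : 0 < κs)
    (hws : ∀ m : ℕ, 1 ≤ m → ∀ (κ l : Fin 4) (x : Pt),
      |colOf (Kp m) κ l x| ≤ Cs / ((Lc ^ m : ℕ) : ℝ) ^ 5 * Real.exp (-(κs / ((Lc ^ m : ℕ) : ℝ)) * l1 x))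
    -- THE ABSTRACT COARSE AND FINE TABLES: the sandwich through the base-`0` columns of `Kp m`; bounded fine entries
    {T : ℕ → Fin 4 → Fin 4 → Pt → ℝ} {F : ℕ → EKer₂ 4}
    (hsand : ∀ m : ℕ, 1 ≤ m → ∀ u : Pt,
      T m μ ν u = dressedEntryP (fun c a => colH (Kp m) (Lc ^ m) a 0 c) (F m) (((Lc ^ m : ℕ) : ℤ) • (-u)) μ ν)
    (hFb : ∀ m : ℕ, 1 ≤ m → ∀ c e : Fin 4, ∃ A, ∀ s s', |F m c e s s'| ≤ A)
    -- the FAR LETTER of the full fine kernel (m-free shape) and the NEAR LEDGER (one number)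
    {CF a : ℝ} (hCF : 0 ≤ CF) (ha : 0 < a)
    (hfar : ∀ m : ℕ, 1 ≤ m → ∀ (c e : Fin 4) (s s' : Pt), Lc ^ m < supNorm (s' - s) →
      |F m c e s s'|
        ≤ ((Lc ^ m : ℕ) : ℝ) ^ 8 * (CF / (supNorm (s' - s) : ℝ) ^ 6 * Real.exp (-(a / ((Lc ^ m : ℕ) : ℝ)) * (supNorm (s' - s) : ℝ))))
    -- the FINITE NEAR LEDGER
    {ι : Type*} (J : Finset ι) {G : ι → ℕ → EKer₂ 4} {B : ι → ℝ}
    (hnearSplit : ∀ m : ℕ, 1 ≤ m → ∀ (c e : Fin 4) (s s' : Pt),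
      (if supNorm (s' - s) ≤ Lc ^ m then
          F m c e s s'
            - ((Lc ^ m : ℕ) : ℝ) ^ 8 * PiBF wg wgh V W v w c e (s' - s) else 0) = ∑ j ∈ J, G j m c e s s')
    (hGb : ∀ j ∈ J, ∀ m : ℕ, 1 ≤ m → ∀ c e : Fin 4, ∃ A, ∀ s s', |G j m c e s s'| ≤ A)
    (hledger : ∀ j ∈ J, ∀ m : ℕ, 1 ≤ m → ∀ S' : Finset Pt, ∑ u ∈ S', (supNorm u : ℝ) ^ 2 *
      |dressedEntryP (fun c a' => colH (Kp m) (Lc ^ m) a' 0 c) (G j m)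
        (((Lc ^ m : ℕ) : ℤ) • (-u)) μ ν| ≤ B j) :
    ∃ U : ℝ, 0 ≤ U ∧ ∃ Cg : ℝ, ∀ m : ℕ, 1 ≤ m →
      |B12Beta.secondMoment (T m) μ ν - (m : ℝ) * stepBal N Lc|
        ≤ (U + ∑ j ∈ J, B j) + Cg := by
  -- the column letter (absolute summability of the END columns) from (LE)
  have hcol : ∀ m, 1 ≤ m → ∀ κ l : Fin 4, Summable fun u => |colOf (Kp m) κ l u| := fun m hm κ l =>
    (hwE m hm κ l).of_nonneg_of_le (fun _ => abs_nonneg _) fun x =>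
      le_mul_of_one_le_left (abs_nonneg _) (Real.one_le_exp (mul_nonneg (by positivity) (l1_nonneg x)))
  have hcolH : ∀ m, 1 ≤ m → ∀ κ l : Fin 4,
      Summable fun u => |(fun c a' => colH (Kp m) (Lc ^ m) a' 0 c) κ l u| :=
    fun m hm κ l => FineSplitJunction.summable_abs_colH_of_colOf (hcol m hm) (Lc ^ m) κ l
  -- the near number is the sum of the ledger
  have hnear : ∀ m : ℕ, 1 ≤ m → ∀ S' : Finset Pt, ∑ u ∈ S', (supNorm u : ℝ) ^ 2 *
      |dressedEntryP (fun c a' => colH (Kp m) (Lc ^ m) a' 0 c)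
        (fun c e s s' => if supNorm (s' - s) ≤ Lc ^ m then
          F m c e s s'
            - ((Lc ^ m : ℕ) : ℝ) ^ 8 * PiBF wg wgh V W v w c e (s' - s) else 0)
        (((Lc ^ m : ℕ) : ℤ) • (-u)) μ ν| ≤ ∑ j ∈ J, B j := fun m hm =>
    rem_dressedEntryP_sum J (w := fun m => fun c a' => colH (Kp m) (Lc ^ m) a' 0 c)
      (Nb := fun m => Lc ^ m) (m := m)
      (F := fun m c e s s' => if supNorm (s' - s) ≤ Lc ^ m then
          F m c e s s'
            - ((Lc ^ m : ℕ) : ℝ) ^ 8 * PiBF wg wgh V W v w c e (s' - s) else 0)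
      (hcolH m hm) (hnearSplit m hm) (fun j hj c e => hGb j hj m hm c e) (fun j hj S' => hledger j hj m hm S')
  exact hasym_PiBF_of_near_far_gen hLc wg wgh hδ hV hW hcovV hcovW X hX hW1 hW2 hKcov h0V hgermV hWloc hv hw hcovv hcovw Xg hXg hW1g hW2g
    h0v hgermv hwloc hn hμν hδc hcc hw0 hw1 hwE hwEb hCs hκs hws hsand hFb hCF ha hfar hnear

end Summit.QuantumFields.BalabanUV.Beta.FP.FineSplitJunctionLedgerGen

end
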